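import Summits.RiemannHypothesis.RiemannHypothesis.Theorems.WeilFormatCArchNodeSumExpansion
import Summits.RiemannHypothesis.RiemannHypothesis.Theorems.WeilFormatCPolyWindowEntryBox
import HarnessLib

/-!
# Format C, design C∞ (E2, data side): kernel boxes for the COLLECTED PROFILE-TABLE COEFFICIENTS `RV(d)`

Route context: Fourier–Galerkin / Schur-complement certificates of Weil positivity on a window ("format C", C∞ door;
cell memo `run/shared/lean/pub/rh-explicit/rh-explicit-weil-2/gen15/E2-PLAN-v2.md` §5; supporting stmt-RiemannHypothesis-0098;
seat rh-explicit-weil-2).  `evenVTable_collected` / `oddVTable_collected` (weil-10, `WeilFormatCCinfVTable`) write the far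
Fourier table of a polynomial profile `Σ_{q∈s} c_q x^q` as `(−1)^m Σ_{d≤D} RV(d)/m^d` with
`RV(d) = Σ_{(q,k): q∈s, k≤q, k+1=d} 2c_q((−1)^k q^{(k)}(a^{q−k} − (−a)^{q−k})(a/π)^{k+1} Re/Im(i^{k+1}))/√(2a)` — EXACTLY,
no remainder.  The rung's dominating `Uq` needs kernel boxes of these numbers (they multiply the free map `Λ` inside the
linear map of `hUqe'`).  Here: `CinfCoeff.evenVTabBox` / `oddVTabBox` from a rational coefficient table `c : ℕ → ℚ`, the power
list `sl` (`s = sl.toFinset`), and input boxes `AP ∋ a/π`, `Rs ∋ 1/√(2a)`; membership for the VERBATIM fiber sums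
(`mem_evenVTabBox`, `mem_oddVTabBox`).  Interval plumbing only; standard axioms; no RH claim.
-/

set_option autoImplicit false
-- `Summit.RiemannHypothesis.RiemannHypothesis.…` is the layout-mandated namespace (summit = problem name).
set_option linter.dupNamespace false

open Finset Complex
open scoped Real

namespace Summit.RiemannHypothesis.RiemannHypothesis.Theorems.WeilFormatC

open Literature.NumberTheory.LFunctions
open Literature.Analysis.ValidatedNumerics Literature.Analysis.ValidatedNumerics.NumericsMP

namespace CinfCoeff

open WinConst (ratBox mem_ratBox mulRatBox mem_mulRatBox)
open WinEntry (sumBox mem_sumBox)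

variable {S : ℕ}

/-! ## Generic pieces -/

/-- `x^n` by repeated outward multiplication (local copy). -/
def powV (S : ℕ) (X : MI) : ℕ → MI
  | 0 => MI.ofInt S 1
  | n + 1 => (powV S X n).mul S X

/-- `powV ∋ x^n`. -/
theorem mem_powV (hS : 0 < S) {x : ℝ} {X : MI} (hx : MI.mem S x X) : ∀ n : ℕ, MI.mem S (x ^ n) (powV S X n)
  | 0 => by simpa [powV] using MI.mem_ofInt S 1
  | n + 1 => by rw [pow_succ, powV]; exact MI.mem_mul hS (mem_powV hS hx n) hx

/-- `Re(i^n)` as a rational (`1, 0, −1, 0` by `n mod 4`). -/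
def reIQ (n : ℕ) : ℚ := if n % 4 = 0 then 1 else if n % 4 = 2 then -1 else 0

/-- `Im(i^n)` as a rational (`0, 1, 0, −1` by `n mod 4`). -/
def imIQ (n : ℕ) : ℚ := if n % 4 = 1 then 1 else if n % 4 = 3 then -1 else 0

/-- `Re(i^n) = reIQ n`. -/
theorem reIQ_cast (n : ℕ) : (I ^ n).re = ((reIQ n : ℚ) : ℝ) := by
  rw [I_pow_eq_I_pow_mod_four n, reIQ]
  have h4 : n % 4 < 4 := Nat.mod_lt _ (by norm_num)
  interval_cases hn : n % 4 <;> simp [pow_succ]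

/-- `Im(i^n) = imIQ n`. -/
theorem imIQ_cast (n : ℕ) : (I ^ n).im = ((imIQ n : ℚ) : ℝ) := by
  rw [I_pow_eq_I_pow_mod_four n, imIQ]
  have h4 : n % 4 < 4 := Nat.mod_lt _ (by norm_num)
  interval_cases hn : n % 4 <;> simp [pow_succ]

/-- A list-indexed sum of boxes. -/
def sumList (S : ℕ) (F : ℕ → MI) : List ℕ → MI
  | [] => MI.ofInt S 0
  | q :: l => (F q).add (sumList S F l)

/-- `sumList ∋ Σ_{q ∈ l.toFinset} g q` for a duplicate-free list. -/
theorem mem_sumList {F : ℕ → MI} {g : ℕ → ℝ} (h : ∀ q, MI.mem S (g q) (F q)) :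
    ∀ (l : List ℕ), l.Nodup → MI.mem S (∑ q ∈ l.toFinset, g q) (sumList S F l)
  | [], _ => by simpa [sumList] using MI.mem_ofInt S 0
  | q :: l, hnd => by
    rw [List.nodup_cons] at hnd
    rw [List.toFinset_cons, Finset.sum_insert (by simpa using hnd.1), sumList]
    exact MI.mem_add (h q) (mem_sumList h l hnd.2)

/-- The filtered range sum used for the inner index `k ≤ q`. -/
def sumFilterV (S : ℕ) (J : ℕ) (p : ℕ → Prop) [DecidablePred p] (F : ℕ → MI) : MI :=
  sumBox S (fun j ↦ if p j then F j else MI.ofInt S 0) J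

/-- `sumFilterV ∋ Σ_{j<J} if p j then g j else 0`. -/
theorem mem_sumFilterV {J : ℕ} {p : ℕ → Prop} [DecidablePred p] {g : ℕ → ℝ} {F : ℕ → MI}
    (h : ∀ j, j < J → p j → MI.mem S (g j) (F j)) :
    MI.mem S (∑ j ∈ Finset.range J, if p j then g j else 0) (sumFilterV S J p F) := by
  rw [sumFilterV]
  refine mem_sumBox J fun j hj ↦ ?_
  by_cases hp : p j
  · rw [if_pos hp, if_pos hp]; exact h j hj hp
  · rw [if_neg hp, if_neg hp]; simpa using MI.mem_ofInt S 0

/-! ## The profile-table coefficients -/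

/-- The rational part of the even term: `2c_q(−1)^k q^{(k)}(a^{q−k} − (−a)^{q−k}) Re(i^{k+1})`. -/
def evenVTermQ (c : ℕ → ℚ) (a : ℚ) (q k : ℕ) : ℚ :=
  2 * c q * ((-1) ^ k * (q.descFactorial k : ℚ) * (a ^ (q - k) - (-a) ^ (q - k)) * reIQ (k + 1))

/-- The rational part of the odd term (with `Im(i^{k+1})`). -/
def oddVTermQ (c : ℕ → ℚ) (a : ℚ) (q k : ℕ) : ℚ :=
  2 * c q * ((-1) ^ k * (q.descFactorial k : ℚ) * (a ^ (q - k) - (-a) ^ (q - k)) * imIQ (k + 1))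

/-- **Even profile-table coefficient box** `RV⁺(d) ∋ evenVTabBox` (inputs `AP ∋ a/π`, `Rs ∋ 1/√(2a)`). -/
def evenVTabBox (S : ℕ) (AP Rs : MI) (c : ℕ → ℚ) (a : ℚ) (sl : List ℕ) (d : ℕ) : MI :=
  sumList S (fun q ↦ sumFilterV S (q + 1) (fun k ↦ k + 1 = d)
    (fun k ↦ mulRatBox ((powV S AP (k + 1)).mul S Rs) (evenVTermQ c a q k))) sl

/-- **Odd profile-table coefficient box** `RV⁻(d) ∋ oddVTabBox`. -/
def oddVTabBox (S : ℕ) (AP Rs : MI) (c : ℕ → ℚ) (a : ℚ) (sl : List ℕ) (d : ℕ) : MI :=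
  sumList S (fun q ↦ sumFilterV S (q + 1) (fun k ↦ k + 1 = d)
    (fun k ↦ mulRatBox ((powV S AP (k + 1)).mul S Rs) (oddVTermQ c a q k))) sl

variable {a : ℚ} {AP Rs : MI}

/-- **`evenVTabBox ∋ RV⁺(d)`**, the `d`-th fiber sum of `evenVTable_collected` with `s = sl.toFinset`,
`c q = (cq q : ℝ)` (verbatim). -/
theorem mem_evenVTabBox (hS : 0 < S) (ha : 0 < a) (hAP : MI.mem S ((a : ℝ) / Real.pi) AP)
    (hRs : MI.mem S (1 / Real.sqrt (2 * (a : ℝ))) Rs) (cq : ℕ → ℚ) {sl : List ℕ} (hsl : sl.Nodup) (d : ℕ) :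
    MI.mem S
      (∑ p ∈ (sl.toFinset.sigma fun q ↦ Finset.range (q + 1)).filter (fun p ↦ p.2 + 1 = d),
          2 * ((cq p.1 : ℚ) : ℝ) * ((-1 : ℝ) ^ p.2 * (p.1.descFactorial p.2 : ℝ)
            * ((a : ℝ) ^ (p.1 - p.2) - (-(a : ℝ)) ^ (p.1 - p.2))
            * ((a : ℝ) / π) ^ (p.2 + 1) * (I ^ (p.2 + 1)).re) / Real.sqrt (2 * (a : ℝ)))
      (evenVTabBox S AP Rs cq a sl d) := by
  rw [Finset.sum_filter, Finset.sum_sigma, evenVTabBox]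
  refine mem_sumList (fun q ↦ ?_) sl hsl
  refine mem_sumFilterV fun k _ _ ↦ ?_
  have hm := mem_mulRatBox (MI.mem_mul hS (mem_powV hS hAP (k + 1)) hRs) (evenVTermQ cq a q k)
  convert hm using 1
  rw [reIQ_cast, evenVTermQ]
  push_cast
  field_simp

/-- **`oddVTabBox ∋ RV⁻(d)`**, the `d`-th fiber sum of `oddVTable_collected` (verbatim). -/
theorem mem_oddVTabBox (hS : 0 < S) (ha : 0 < a) (hAP : MI.mem S ((a : ℝ) / Real.pi) AP)
    (hRs : MI.mem S (1 / Real.sqrt (2 * (a : ℝ))) Rs) (cq : ℕ → ℚ) {sl : List ℕ} (hsl : sl.Nodup) (d : ℕ) :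
    MI.mem S
      (∑ p ∈ (sl.toFinset.sigma fun q ↦ Finset.range (q + 1)).filter (fun p ↦ p.2 + 1 = d),
          2 * ((cq p.1 : ℚ) : ℝ) * ((-1 : ℝ) ^ p.2 * (p.1.descFactorial p.2 : ℝ)
            * ((a : ℝ) ^ (p.1 - p.2) - (-(a : ℝ)) ^ (p.1 - p.2))
            * ((a : ℝ) / π) ^ (p.2 + 1) * (I ^ (p.2 + 1)).im) / Real.sqrt (2 * (a : ℝ)))
      (oddVTabBox S AP Rs cq a sl d) := by
  rw [Finset.sum_filter, Finset.sum_sigma, oddVTabBox]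
  refine mem_sumList (fun q ↦ ?_) sl hsl
  refine mem_sumFilterV fun k _ _ ↦ ?_
  have hm := mem_mulRatBox (MI.mem_mul hS (mem_powV hS hAP (k + 1)) hRs) (oddVTermQ cq a q k)
  convert hm using 1
  rw [imIQ_cast, oddVTermQ]
  push_cast
  field_simp

end CinfCoeff

end Summit.RiemannHypothesis.RiemannHypothesis.Theorems.WeilFormatC
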